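import Mathlib
import HarnessLib
import Summits.NavierStokesRegularity.FluidComputer.TriggeredTransferCascadeTypeII
import Literature.Analysis.FluidPDE.TaoForcedEnergyBoundDischarge

/-!
# The blow-up of a cascade is MAXIMAL at `T*`, stays in the ENERGY CLASS up to `T*`, and is either
# Type II or made of instantaneous transfers (door N1-FC, analysis half: the portrait of the witness)

Cell `ns-blowup`, seat `ns-blowup-fc-prover-1` (g6; D-0074 GROUP C «bridge support», door N1-FC).
Companion of `TriggeredTransferCascadeWitness.lean` (g5) and `TriggeredTransferCascadeTypeII.lean`
(g6): the glued witness `ρ.limitVel hν` of a cascade `ρ : 𝒮.Cascade ν` (`ν > 0`) — an exact classical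
solution on `[0, T*)` of the system forced by the summed trigger `ρ.force`, singular at
`(T*, limitCentre)`. LABEL: E–C bookkeeping (real analysis over the TYPE `Cascade` + ONE tree theorem
of the Tao 2013 forced theory). WHAT THIS IS NOT: not Navier–Stokes evidence and not a construction —
`Cascade ν` is inhabited only under the OPEN door predicates (`TriggerScheme.Transfers`,
`TriggerSchemeH1.Transfers{,Seeded}`), asserted nowhere; no scheme, cascade, transfer or blow-up is
claimed; nothing here is an item of any route.

* **`Cascade.not_hasSmoothExtensionPast`, `Cascade.isMaximalSmoothSolution`** — the lifespan is
  EXACTLY `T*`: a classical solution of the same forced system on `[0, T')`, `T' > T*`, agreeing with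
  the witness on `[0, T*)` would be bounded on the compact `[T*/2, T*] × B̄(limitCentre, 1)`, where
  the witness is unbounded (`exists_mem_parabolicCylinder_lt_norm`). So every tree criterion stated
  for a forced `IsMaximalSmoothSolution` applies to the witness by name.
* **`Cascade.energy_bounded`**, **`Cascade.lintegral_dissipation_lt_top`** — UNIFORMLY BOUNDED
  ENERGY `sup_{t<T*} ∫|u(t)|² < ∞` and FINITE DISSIPATION `∫₀^{T*}∫|∇u|² < ∞`, by the tree THEOREM
  `tao2011_forced_finiteEnergy_energyBound_holds` (Tao 2013, Lemma 8.1 WITH force, absolute constant)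
  on every closed sub-slab and a monotone union: an ENERGY-CLASS (Leray–Hopf-type) singularity with
  unbounded speed at one space–time point — the class of the Type I / Type II and `L³` theory
  (Seregin 2012; Escauriaza–Seregin–Šverák 2003) — not an energy blow-up.
* `Cascade.isTypeIBlowup_or_isTypeIIBlowup`, `eventually_T_le_of_isTypeIBlowup`,
  `eventually_T_le_or_isTypeIIBlowup` — the dichotomy in the door's words: EITHER the transfers become
  instantaneous in their own clock (`T_n ≤ K²/U_n²` for large `n`) OR the blow-up is Type II.
* `Cascade.portrait`; door level `TriggerScheme.exists_witness_portrait_of_transfers` (v1),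
  `TriggerSchemeH1.exists_witness_portrait_of_transfers{,Seeded}` (v2).

References: [cite: Tao2011, Lemma 8.1] (Anal. PDE 6 (2013), arXiv Lemma 44); [cite: Tao2016AveragedNS, §1.3];
[cite: BealeKatoMajda1984, §1]; [cite: Seregin2012, §1]. 0 sorry; axioms ⊆ {propext, Classical.choice, Quot.sound}.
-/

noncomputable section

namespace Summit.NavierStokesRegularity.FluidComputer.TriggeredTransfer

open Set Filter Function MeasureTheory Metric
open scoped Topology ENNReal
open Literature.Analysis.FluidPDE
open Literature.Analysis.FluidPDE.FluidComputer (E3 Vel)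
open Summit.NavierStokesRegularity.FluidComputer.PalasekTowerClayBridge (BreakdownWitness)

namespace TriggerScheme

namespace Cascade

variable {𝒮 : TriggerScheme} {ν : ℝ}

/-! ## Maximality: the lifespan of the witness is exactly `T*` -/

/-- **No classical extension past `T*`.** A classical solution of the same forced system on `[0, T')`,
`T' > T*`, agreeing with the witness on `[0, T*)`, would be continuous — hence bounded — on the
compact `[T*/2, T*] × B̄(limitCentre, 1)`, inside which the witness takes arbitrarily large values
(`exists_mem_parabolicCylinder_lt_norm` with `r = min 1 (T*/2)`). [cite: BealeKatoMajda1984, §1] -/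
theorem not_hasSmoothExtensionPast (ρ : 𝒮.Cascade ν) (hν : 0 < ν) :
    ¬ HasSmoothExtensionPast ν ρ.force (ρ.limitVel hν) ρ.Tstar := by
  rintro ⟨T', hT', u', p', hsol, hagree⟩
  have hT := ρ.Tstar_pos hν
  set K : Set (ℝ × E3) := Icc (ρ.Tstar / 2) ρ.Tstar ×ˢ closedBall ρ.limitCentre 1 with hK_def
  have hK : IsCompact K := isCompact_Icc.prod (isCompact_closedBall _ _)
  have hKsub : K ⊆ Ico 0 T' ×ˢ univ :=
    prod_mono (fun t ht => ⟨by linarith [ht.1], ht.2.trans_lt hT'⟩) (subset_univ _)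
  have hcont : ContinuousOn (uncurry u') K := hsol.smooth_velocity.continuousOn.mono hKsub
  obtain ⟨M, hM⟩ := hK.exists_bound_of_continuousOn hcont
  have hr : 0 < min 1 (ρ.Tstar / 2) := lt_min one_pos (by linarith)
  obtain ⟨z, hzQ, hz0, hzM⟩ := ρ.exists_mem_parabolicCylinder_lt_norm hν hr M
  rw [mem_parabolicCylinder] at hzQ
  obtain ⟨⟨hz1, hz2⟩, hz3⟩ := hzQ
  have hr1 : min 1 (ρ.Tstar / 2) ≤ 1 := min_le_left _ _
  have hr2 : min 1 (ρ.Tstar / 2) ^ 2 ≤ ρ.Tstar / 2 := by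
    calc min 1 (ρ.Tstar / 2) ^ 2 ≤ min 1 (ρ.Tstar / 2) * 1 := by
          rw [sq]; exact mul_le_mul_of_nonneg_left hr1 hr.le
      _ ≤ ρ.Tstar / 2 := by rw [mul_one]; exact min_le_right _ _
  have hzK : z ∈ K := by
    refine ⟨⟨?_, ?_⟩, ?_⟩
    · have : ρ.Tstar - min 1 (ρ.Tstar / 2) ^ 2 < z.1 := by simpa using hz1
      linarith
    · exact le_of_lt (by simpa using hz2)
    · exact mem_closedBall.2 ((le_of_lt (by simpa using hz3)).trans hr1)
  have hbound := hM z hzK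
  have hzT : z.1 < ρ.Tstar := by simpa using hz2
  have heq : uncurry u' z = uncurry (ρ.limitVel hν) z := by
    obtain ⟨t, x⟩ := z
    simp only [uncurry_apply_pair]
    rw [hagree t ⟨hz0.le, hzT⟩]
  rw [heq] at hbound
  exact (lt_irrefl M) (hzM.trans_le hbound)

/-- **The witness is a MAXIMAL smooth solution with lifespan `T*`** (`IsMaximalSmoothSolution`:
classical on `[0, T*)` for the summed force, no classical extension past `T*`). [cite: BealeKatoMajda1984, §1] -/
theorem isMaximalSmoothSolution (ρ : 𝒮.Cascade ν) (hν : 0 < ν) :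
    IsMaximalSmoothSolution ν ρ.force (ρ.limitVel hν) (ρ.limitPrs hν) ρ.Tstar :=
  ⟨ρ.limit_classical hν, ρ.not_hasSmoothExtensionPast hν⟩

/-! ## The summed trigger has finite `L¹_t L²_x` norm -/

/-- **Size of the summed force on the window of level `n`**: `‖force(t, x)‖ ≤ A₀ · (mag n)³ · ε_n`
for `start n ≤ t < stop n` (there the summed force IS the zoomed trigger of level `n`). [folklore] -/
theorem norm_force_le (ρ : 𝒮.Cascade ν) {n : ℕ} {t : ℝ} (h1 : ρ.start n ≤ t) (h2 : t < ρ.stop n) (x : E3) :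
    ‖ρ.force t x‖ ≤ 𝒮.A 0 * (𝒮.mag n ^ 3 * 𝒮.seedAt ν n (ρ.U n)) := by
  rw [ρ.force_eq_frc h1 h2]
  have h := ρ.norm_iteratedFDeriv_frc_le n 0 (t, x)
  simpa using h

/-- The summed force vanishes outside the blow-up ball `B̄(0, ballRadius)`. [folklore] -/
theorem force_apply_eq_zero_of_far (ρ : 𝒮.Cascade ν) (t : ℝ) {x : E3} (hx : 𝒮.ballRadius ≤ ‖x‖) :
    ρ.force t x = 0 := by
  simp [force, ρ.frc_apply_eq_zero_of_far t hx]

/-- The size constant of level `n` is nonnegative. [folklore] -/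
theorem frc_bound_nonneg (ρ : 𝒮.Cascade ν) (n : ℕ) : 0 ≤ 𝒮.A 0 * (𝒮.mag n ^ 3 * 𝒮.seedAt ν n (ρ.U n)) :=
  mul_nonneg (𝒮.A_nonneg 0) (mul_nonneg (pow_nonneg (𝒮.mag_pos n).le 3) (𝒮.seedAt_pos ν n _).le)

/-- **`L²` size of a slice of the summed force** on the window of level `n`:
`∫ ‖force t‖² ≤ (A₀ (mag n)³ ε_n)² · |B(0, ballRadius)|`. [folklore] -/
theorem lintegral_force_sq_le (ρ : 𝒮.Cascade ν) {n : ℕ} {t : ℝ} (h1 : ρ.start n ≤ t) (h2 : t < ρ.stop n) :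
    ∫⁻ x, ‖ρ.force t x‖ₑ ^ 2 ≤
      ENNReal.ofReal ((𝒮.A 0 * (𝒮.mag n ^ 3 * 𝒮.seedAt ν n (ρ.U n))) ^ 2) *
        volume (ball (0 : E3) 𝒮.ballRadius) := by
  set c : ℝ := 𝒮.A 0 * (𝒮.mag n ^ 3 * 𝒮.seedAt ν n (ρ.U n)) with hc_def
  rw [← lintegral_indicator_const measurableSet_ball]
  refine lintegral_mono fun x => ?_
  by_cases hx : x ∈ ball (0 : E3) 𝒮.ballRadius
  · rw [indicator_of_mem hx, ← ofReal_norm, ← ENNReal.ofReal_pow (norm_nonneg _)]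
    exact ENNReal.ofReal_le_ofReal (pow_le_pow_left₀ (norm_nonneg _) (ρ.norm_force_le h1 h2 x) 2)
  · have hfar : 𝒮.ballRadius ≤ ‖x‖ := by simpa [mem_ball, dist_zero_right] using hx
    rw [indicator_of_notMem hx, ρ.force_apply_eq_zero_of_far t hfar]
    simp

/-- The square root of the slice bound: `((c²) · V)^{1/2} = c · V^{1/2}` for `c ≥ 0`. [folklore] -/
theorem sqrt_sliceBound (c : ℝ) (hc : 0 ≤ c) (V : ℝ≥0∞) :
    (ENNReal.ofReal (c ^ 2) * V) ^ (1 / 2 : ℝ) = ENNReal.ofReal c * V ^ (1 / 2 : ℝ) := by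
  rw [ENNReal.mul_rpow_of_nonneg _ _ (by norm_num : (0 : ℝ) ≤ 1 / 2),
    ENNReal.ofReal_rpow_of_nonneg (sq_nonneg c) (by norm_num : (0 : ℝ) ≤ 1 / 2),
    ← Real.sqrt_eq_rpow, Real.sqrt_sq hc]

/-- The level-`n` bound of `‖force(t)‖_{L²}`: `b n = A₀ (mag n)³ ε_n · |B(0, ballRadius)|^{1/2}`. [folklore] -/
theorem lintegral_force_sq_rpow_le (ρ : 𝒮.Cascade ν) {n : ℕ} {t : ℝ} (h1 : ρ.start n ≤ t) (h2 : t < ρ.stop n) :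
    (∫⁻ x, ‖ρ.force t x‖ₑ ^ 2) ^ (1 / 2 : ℝ) ≤
      ENNReal.ofReal (𝒮.A 0 * (𝒮.mag n ^ 3 * 𝒮.seedAt ν n (ρ.U n))) *
        volume (ball (0 : E3) 𝒮.ballRadius) ^ (1 / 2 : ℝ) := by
  rw [← sqrt_sliceBound _ (ρ.frc_bound_nonneg n)]
  exact ENNReal.rpow_le_rpow (ρ.lintegral_force_sq_le h1 h2) (by norm_num)

/-- Every time in `[0, T*)` lies in the window `[start n, stop n)` of some level. [folklore] -/
theorem exists_window (ρ : 𝒮.Cascade ν) (hν : 0 < ν) {t : ℝ} (h0 : 0 ≤ t) (ht : t < ρ.Tstar) :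
    ∃ n, ρ.start n ≤ t ∧ t < ρ.stop n := by
  classical
  refine ⟨Nat.find (ρ.exists_lt_stop hν ht), ?_, Nat.find_spec (ρ.exists_lt_stop hν ht)⟩
  rcases Nat.eq_zero_or_pos (Nat.find (ρ.exists_lt_stop hν ht)) with h | h
  · rw [h, ρ.start_zero]; exact h0
  · obtain ⟨k, hk⟩ := Nat.exists_eq_succ_of_ne_zero h.ne'
    have hmin : ¬ t < ρ.stop k := Nat.find_min (ρ.exists_lt_stop hν ht) (by rw [hk]; exact Nat.lt_succ_self k)
    rw [hk]
    exact (ρ.start_succ_lt_stop k).le.trans (not_lt.1 hmin)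

/-- **The `L¹_t L²_x` budget of the summed force is finite, uniformly before `T*`**:
`∫₀^{T'} ‖force(t)‖_{L²} dt ≤ T* · |B(0, ballRadius)|^{1/2} · Σ_n A₀ (mag n)³ ε_n` for every `T' < T*`. [folklore] -/
theorem lintegral_sqrt_force_sq_le (ρ : 𝒮.Cascade ν) (hν : 0 < ν) {T' : ℝ} (hT' : T' < ρ.Tstar) :
    ∫⁻ t in Icc 0 T', (∫⁻ x, ‖ρ.force t x‖ₑ ^ 2) ^ (1 / 2 : ℝ) ≤
      ENNReal.ofReal ρ.Tstar * (volume (ball (0 : E3) 𝒮.ballRadius) ^ (1 / 2 : ℝ) *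
        ENNReal.ofReal (∑' n, 𝒮.A 0 * (𝒮.mag n ^ 3 * 𝒮.seedAt ν n (ρ.U n)))) := by
  set V : ℝ≥0∞ := volume (ball (0 : E3) 𝒮.ballRadius) ^ (1 / 2 : ℝ) with hV_def
  set b : ℕ → ℝ≥0∞ := fun n => ENNReal.ofReal (𝒮.A 0 * (𝒮.mag n ^ 3 * 𝒮.seedAt ν n (ρ.U n))) * V
    with hb_def
  set g : ℝ → ℝ≥0∞ := fun t => ∑' n, (Ico (ρ.start n) (ρ.stop n)).indicator (fun _ => b n) t with hg_def
  -- pointwise domination on `[0, T']`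
  have hdom : ∀ t ∈ Icc 0 T', (∫⁻ x, ‖ρ.force t x‖ₑ ^ 2) ^ (1 / 2 : ℝ) ≤ g t := by
    intro t ht
    obtain ⟨n, h1, h2⟩ := ρ.exists_window hν ht.1 (ht.2.trans_lt hT')
    calc (∫⁻ x, ‖ρ.force t x‖ₑ ^ 2) ^ (1 / 2 : ℝ) ≤ b n := ρ.lintegral_force_sq_rpow_le h1 h2
      _ = (Ico (ρ.start n) (ρ.stop n)).indicator (fun _ => b n) t := by rw [indicator_of_mem (show t ∈ Ico _ _ from ⟨h1, h2⟩)]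
      _ ≤ g t := ENNReal.le_tsum n
  -- integrate the majorant over all of `ℝ`
  have hwin : ∀ n, volume (Ico (ρ.start n) (ρ.stop n)) ≤ ENNReal.ofReal ρ.Tstar := fun n => by
    rw [Real.volume_Ico]
    exact ENNReal.ofReal_le_ofReal (by linarith [ρ.start_nonneg n, ρ.stop_lt_Tstar hν n])
  calc ∫⁻ t in Icc 0 T', (∫⁻ x, ‖ρ.force t x‖ₑ ^ 2) ^ (1 / 2 : ℝ)
      ≤ ∫⁻ t in Icc 0 T', g t := setLIntegral_mono' measurableSet_Icc hdom
    _ ≤ ∫⁻ t, g t := setLIntegral_le_lintegral _ _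
    _ = ∑' n, ∫⁻ t, (Ico (ρ.start n) (ρ.stop n)).indicator (fun _ => b n) t :=
        lintegral_tsum fun n => (measurable_const.indicator measurableSet_Ico).aemeasurable
    _ = ∑' n, b n * volume (Ico (ρ.start n) (ρ.stop n)) := by
        congr 1; funext n; rw [lintegral_indicator_const measurableSet_Ico]
    _ ≤ ∑' n, b n * ENNReal.ofReal ρ.Tstar := ENNReal.tsum_le_tsum fun n => by gcongr; exact hwin n
    _ = ENNReal.ofReal ρ.Tstar * (V * ∑' n, ENNReal.ofReal (𝒮.A 0 * (𝒮.mag n ^ 3 * 𝒮.seedAt ν n (ρ.U n)))) := by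
        rw [ENNReal.tsum_mul_right, mul_comm, hb_def]
        simp_rw [mul_comm (ENNReal.ofReal _) V]
        rw [ENNReal.tsum_mul_left]
    _ = _ := by rw [← ENNReal.ofReal_tsum_of_nonneg (ρ.frc_bound_nonneg) (ρ.summable_frc_bound hν 0)]

/-- The `L¹_t L²_x` budget as a finite constant independent of `T'`. [folklore] -/
theorem lintegral_sqrt_force_sq_lt_top_uniform (ρ : 𝒮.Cascade ν) (hν : 0 < ν) :
    ∃ I : ℝ≥0∞, I < ⊤ ∧ ∀ T', T' < ρ.Tstar →
      ∫⁻ t in Icc 0 T', (∫⁻ x, ‖ρ.force t x‖ₑ ^ 2) ^ (1 / 2 : ℝ) ≤ I := by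
  refine ⟨_, ?_, fun T' hT' => ρ.lintegral_sqrt_force_sq_le hν hT'⟩
  refine ENNReal.mul_lt_top ENNReal.ofReal_lt_top (ENNReal.mul_lt_top ?_ ENNReal.ofReal_lt_top)
  exact ENNReal.rpow_lt_top_of_nonneg (by norm_num) (measure_ball_lt_top).ne

/-! ## The energy class: bounded energy and finite dissipation up to `T*` -/

/-- The summed force is smooth on every closed slab `[0, T'] × ℝ³`. [folklore] -/
theorem isSmoothSpaceTimeOn_force (ρ : 𝒮.Cascade ν) (hν : 0 < ν) (T' : ℝ) :
    IsSmoothSpaceTimeOn (Icc 0 T') ρ.force :=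
  (ρ.force_clay hν).1.mono (prod_mono (fun _ ht => ht.1) Subset.rfl)

/-- **Tao's forced energy inequality along the witness** (Lemma 8.1 WITH force, tree theorem
`tao2011_forced_finiteEnergy_energyBound_holds`): for `0 < T' < T*`, with the theorem's absolute
constant `C`, `∫|u(t)|² ≤ C (‖u(0)‖_{L²} + ∫₀^{T'} ‖force‖_{L²})²` on `[0, T']` and
`ν ∫₀^{T'} ∫ |∇u|² ≤` the same. [cite: Tao2011, Lemma 8.1] -/
theorem energy_dissipation_le_slab (ρ : 𝒮.Cascade ν) (hν : 0 < ν) :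
    ∃ C : ℝ≥0∞, C < ⊤ ∧ ∀ T', 0 < T' → T' < ρ.Tstar →
      (∀ t ∈ Icc 0 T', ∫⁻ x, ‖ρ.limitVel hν t x‖ₑ ^ 2 ≤
          C * ((∫⁻ x, ‖ρ.limitVel hν 0 x‖ₑ ^ 2) ^ (1 / 2 : ℝ) +
            ∫⁻ t in Icc 0 T', (∫⁻ x, ‖ρ.force t x‖ₑ ^ 2) ^ (1 / 2 : ℝ)) ^ 2) ∧
        ENNReal.ofReal ν * ∫⁻ t in Ioo 0 T',
            ∫⁻ x, ENNReal.ofReal (frobeniusNormSq (fderiv ℝ (ρ.limitVel hν t) x)) ≤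
          C * ((∫⁻ x, ‖ρ.limitVel hν 0 x‖ₑ ^ 2) ^ (1 / 2 : ℝ) +
            ∫⁻ t in Icc 0 T', (∫⁻ x, ‖ρ.force t x‖ₑ ^ 2) ^ (1 / 2 : ℝ)) ^ 2 := by
  obtain ⟨C, hC, H⟩ := tao2011_forced_finiteEnergy_energyBound_holds
  refine ⟨C, hC, fun T' hT'0 hT' => ?_⟩
  have hsol : IsClassicalNSSolutionOn (Icc 0 T') ν ρ.force (ρ.limitVel hν) (ρ.limitPrs hν) :=
    (ρ.limit_classical hν).mono (Icc_subset_Ico_right hT') (uniqueDiffOn_Icc hT'0)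
  have hfE : ∫⁻ t in Icc 0 T', (∫⁻ x, ‖ρ.force t x‖ₑ ^ 2) ^ (1 / 2 : ℝ) < ⊤ := by
    obtain ⟨I, hI, hle⟩ := ρ.lintegral_sqrt_force_sq_lt_top_uniform hν
    exact (hle T' hT').trans_lt hI
  have hE : ∃ A : NNReal, ∀ t ∈ Icc 0 T', ∫⁻ x, ‖ρ.limitVel hν t x‖ₑ ^ 2 ≤ A := by
    obtain ⟨C₀, hC₀, hb⟩ := ρ.limit_energy hν hT'
    exact ⟨C₀.toNNReal, fun t ht => (hb t ht).trans (ENNReal.coe_toNNReal hC₀.ne).ge⟩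
  exact H hν hT'0 hsol (ρ.isSmoothSpaceTimeOn_force hν T') hfE hE

/-- **UNIFORMLY BOUNDED ENERGY UP TO `T*`.** There is `B < ∞` with `∫ |u(t)|² ≤ B` for every
`0 ≤ t < T*`: the witness stays in `L^∞_t L²_x([0, T*))` — the blow-up is not an energy blow-up.
[cite: Tao2011, Lemma 8.1] -/
theorem energy_bounded (ρ : 𝒮.Cascade ν) (hν : 0 < ν) :
    ∃ B : ℝ≥0∞, B < ⊤ ∧ ∀ t ∈ Ico 0 ρ.Tstar, ∫⁻ x, ‖ρ.limitVel hν t x‖ₑ ^ 2 ≤ B := by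
  obtain ⟨C, hC, H⟩ := ρ.energy_dissipation_le_slab hν
  obtain ⟨I, hI, hIle⟩ := ρ.lintegral_sqrt_force_sq_lt_top_uniform hν
  -- the datum's energy is finite
  have hT := ρ.Tstar_pos hν
  obtain ⟨C₀, hC₀, hb₀⟩ := ρ.limit_energy hν (show ρ.Tstar / 2 < ρ.Tstar by linarith)
  have h0 : ∫⁻ x, ‖ρ.limitVel hν 0 x‖ₑ ^ 2 ≤ C₀ := hb₀ 0 ⟨le_rfl, by linarith⟩
  set E0 : ℝ≥0∞ := (∫⁻ x, ‖ρ.limitVel hν 0 x‖ₑ ^ 2) ^ (1 / 2 : ℝ) with hE0_def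
  have hE0 : E0 < ⊤ := ENNReal.rpow_lt_top_of_nonneg (by norm_num) (h0.trans_lt hC₀).ne
  refine ⟨C * (E0 + I) ^ 2, ?_, fun t ht => ?_⟩
  · exact ENNReal.mul_lt_top hC (ENNReal.pow_lt_top (ENNReal.add_lt_top.2 ⟨hE0, hI⟩))
  · -- work on the closed slab `[0, T']`, `T' = (t + T*)/2`
    set T' : ℝ := (t + ρ.Tstar) / 2 with hT'_def
    have hT'0 : 0 < T' := by have := ht.1; rw [hT'_def]; linarith
    have hT'1 : T' < ρ.Tstar := by have := ht.2; rw [hT'_def]; linarith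
    have htT' : t ∈ Icc 0 T' := ⟨ht.1, by have := ht.2; rw [hT'_def]; linarith⟩
    calc ∫⁻ x, ‖ρ.limitVel hν t x‖ₑ ^ 2
        ≤ C * (E0 + ∫⁻ s in Icc 0 T', (∫⁻ x, ‖ρ.force s x‖ₑ ^ 2) ^ (1 / 2 : ℝ)) ^ 2 :=
          (H T' hT'0 hT'1).1 t htT'
      _ ≤ C * (E0 + I) ^ 2 := by gcongr; exact hIle T' hT'1

/-- **Dissipation bound on every sub-slab**: `ν ∫₀^{T'} ∫ |∇u|² ≤ B` with `B < ∞` independent of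
`T' < T*`. [cite: Tao2011, Lemma 8.1] -/
theorem dissipation_le (ρ : 𝒮.Cascade ν) (hν : 0 < ν) :
    ∃ B : ℝ≥0∞, B < ⊤ ∧ ∀ T', T' < ρ.Tstar →
      ENNReal.ofReal ν * ∫⁻ t in Ioo 0 T',
        ∫⁻ x, ENNReal.ofReal (frobeniusNormSq (fderiv ℝ (ρ.limitVel hν t) x)) ≤ B := by
  obtain ⟨C, hC, H⟩ := ρ.energy_dissipation_le_slab hν
  obtain ⟨I, hI, hIle⟩ := ρ.lintegral_sqrt_force_sq_lt_top_uniform hν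
  have hT := ρ.Tstar_pos hν
  obtain ⟨C₀, hC₀, hb₀⟩ := ρ.limit_energy hν (show ρ.Tstar / 2 < ρ.Tstar by linarith)
  have h0 : ∫⁻ x, ‖ρ.limitVel hν 0 x‖ₑ ^ 2 ≤ C₀ := hb₀ 0 ⟨le_rfl, by linarith⟩
  set E0 : ℝ≥0∞ := (∫⁻ x, ‖ρ.limitVel hν 0 x‖ₑ ^ 2) ^ (1 / 2 : ℝ) with hE0_def
  have hE0 : E0 < ⊤ := ENNReal.rpow_lt_top_of_nonneg (by norm_num) (h0.trans_lt hC₀).ne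
  refine ⟨C * (E0 + I) ^ 2, ?_, fun T' hT'1 => ?_⟩
  · exact ENNReal.mul_lt_top hC (ENNReal.pow_lt_top (ENNReal.add_lt_top.2 ⟨hE0, hI⟩))
  · rcases le_or_gt T' 0 with hle | hT'0
    · rw [Ioo_eq_empty (by exact not_lt.2 hle), Measure.restrict_empty, lintegral_zero_measure, mul_zero]
      exact bot_le
    · calc ENNReal.ofReal ν * ∫⁻ t in Ioo 0 T',
            ∫⁻ x, ENNReal.ofReal (frobeniusNormSq (fderiv ℝ (ρ.limitVel hν t) x))
          ≤ C * (E0 + ∫⁻ s in Icc 0 T', (∫⁻ x, ‖ρ.force s x‖ₑ ^ 2) ^ (1 / 2 : ℝ)) ^ 2 :=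
            (H T' hT'0 hT'1).2
        _ ≤ C * (E0 + I) ^ 2 := by gcongr; exact hIle T' hT'1

/-- **FINITE TOTAL DISSIPATION UP TO `T*`**: `ν ∫₀^{T*} ∫ |∇u(t, x)|² dx dt < ∞` (monotone union of
the sub-slabs `(0, stop n) ↑ (0, T*)`). With `energy_bounded`: the witness is in the Leray–Hopf energy
class `L^∞_t L²_x ∩ L²_t Ḣ¹_x` on `[0, T*)`. [cite: Tao2011, Lemma 8.1] -/
theorem lintegral_dissipation_lt_top (ρ : 𝒮.Cascade ν) (hν : 0 < ν) :
    ∫⁻ t in Ioo 0 ρ.Tstar,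
        ∫⁻ x, ENNReal.ofReal (frobeniusNormSq (fderiv ℝ (ρ.limitVel hν t) x)) < ⊤ := by
  obtain ⟨B, hB, H⟩ := ρ.dissipation_le hν
  have hU : Ioo 0 ρ.Tstar = ⋃ n, Ioo 0 (ρ.stop n) := by
    apply Subset.antisymm
    · intro t ht
      obtain ⟨n, hn⟩ := ρ.exists_lt_stop hν ht.2
      exact mem_iUnion.2 ⟨n, ht.1, hn⟩
    · exact iUnion_subset fun n => Ioo_subset_Ioo_right (ρ.stop_lt_Tstar hν n).le
  have hdir : Directed (· ⊆ ·) (fun n => Ioo (0 : ℝ) (ρ.stop n)) :=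
    (monotone_nat_of_le_succ fun n => Ioo_subset_Ioo_right (ρ.stop_lt_stop_succ n).le).directed_le
  rw [hU, setLIntegral_iUnion_of_directed _ hdir]
  have hν' : ENNReal.ofReal ν ≠ 0 := (ENNReal.ofReal_pos.2 hν).ne'
  refine (iSup_le fun n => ?_).trans_lt (ENNReal.div_lt_top hB.ne hν')
  rw [ENNReal.le_div_iff_mul_le (Or.inl hν') (Or.inl ENNReal.ofReal_ne_top), mul_comm]
  exact H (ρ.stop n) (ρ.stop_lt_Tstar hν n)

/-! ## Portrait of the blow-up the door produces -/

/-- **Portrait of the cascade's blow-up.** The glued witness is a MAXIMAL classical solution of the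
forced system with lifespan exactly `T*`; `T*` is a SINGULAR TIME (CKN-singular point at the limit
centre, `TriggeredTransferCascadeTypeII`); the ENERGY stays BOUNDED on `[0, T*)`; the total
DISSIPATION `∫₀^{T*}∫|∇u|²` is FINITE. (Type II under a turnover floor:
`Cascade.isTypeIIBlowup_of_turnover_floor`.) [cite: Seregin2012, §1] -/
theorem portrait (ρ : 𝒮.Cascade ν) (hν : 0 < ν) :
    IsMaximalSmoothSolution ν ρ.force (ρ.limitVel hν) (ρ.limitPrs hν) ρ.Tstar ∧
      IsSingularTime (ρ.limitVel hν) ρ.Tstar ∧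
      (∃ B : ℝ≥0∞, B < ⊤ ∧ ∀ t ∈ Ico 0 ρ.Tstar, ∫⁻ x, ‖ρ.limitVel hν t x‖ₑ ^ 2 ≤ B) ∧
      ∫⁻ t in Ioo 0 ρ.Tstar,
          ∫⁻ x, ENNReal.ofReal (frobeniusNormSq (fderiv ℝ (ρ.limitVel hν t) x)) < ⊤ :=
  ⟨ρ.isMaximalSmoothSolution hν, ρ.isSingularTime hν, ρ.energy_bounded hν,
    ρ.lintegral_dissipation_lt_top hν⟩

/-! ## The Type I / Type II dichotomy for the witness, and where Type I could hide -/

/-- **The dichotomy is exhaustive for the witness** (`T*` is a singular time). [cite: Seregin2012, §1] -/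
theorem isTypeIBlowup_or_isTypeIIBlowup (ρ : 𝒮.Cascade ν) (hν : 0 < ν) :
    IsTypeIBlowup (ρ.limitVel hν) ρ.Tstar ∨ IsTypeIIBlowup (ρ.limitVel hν) ρ.Tstar :=
  (em (IsTypeIBlowup (ρ.limitVel hν) ρ.Tstar)).imp_right fun h => ⟨ρ.isSingularTime hν, h⟩

/-- **Where Type I could hide**: if the witness IS Type I then `U_n √T_n ≤ K` for large `n`
(contrapositive of `Cascade.not_isTypeIBlowup_of_frequently`). [cite: Seregin2012, §1] -/
theorem eventually_clock_le_of_isTypeIBlowup (ρ : 𝒮.Cascade ν) (hν : 0 < ν)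
    (h : IsTypeIBlowup (ρ.limitVel hν) ρ.Tstar) :
    ∃ K : ℝ, ∀ᶠ n in atTop, ρ.U n * Real.sqrt (ρ.link n).T ≤ K := by
  by_contra hK
  refine ρ.not_isTypeIBlowup_of_frequently hν (fun C => ?_) h
  exact (Filter.not_eventually.1 fun hc => hK ⟨C, hc⟩).mono fun n hn => not_le.1 hn

/-- Under Type I, `T_n ≤ K²/U_n²` for large `n`: level `n` hands over within `O(Re_n⁻²)` of its own
unit time (`o(1)` turnovers — instantaneous transfers). [cite: Seregin2012, §1] -/
theorem eventually_T_le_of_isTypeIBlowup (ρ : 𝒮.Cascade ν) (hν : 0 < ν)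
    (h : IsTypeIBlowup (ρ.limitVel hν) ρ.Tstar) :
    ∃ K : ℝ, ∀ᶠ n in atTop, (ρ.link n).T ≤ K ^ 2 / ρ.U n ^ 2 := by
  obtain ⟨K, hK⟩ := ρ.eventually_clock_le_of_isTypeIBlowup hν h
  refine ⟨K, hK.mono fun n hn => ?_⟩
  have hU := ρ.U_pos n
  rw [le_div_iff₀ (pow_pos hU 2)]
  calc (ρ.link n).T * ρ.U n ^ 2 = (ρ.U n * Real.sqrt (ρ.link n).T) ^ 2 := by
        rw [mul_pow, Real.sq_sqrt (ρ.link n).T_pos.le]; ring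
    _ ≤ K ^ 2 := pow_le_pow_left₀ (mul_nonneg hU.le (Real.sqrt_nonneg _)) hn 2

/-- **EITHER instantaneous transfers (`T_n ≤ K²/U_n²` eventually) OR Type II.** [cite: Seregin2012, §1] -/
theorem eventually_T_le_or_isTypeIIBlowup (ρ : 𝒮.Cascade ν) (hν : 0 < ν) :
    (∃ K : ℝ, ∀ᶠ n in atTop, (ρ.link n).T ≤ K ^ 2 / ρ.U n ^ 2) ∨
      IsTypeIIBlowup (ρ.limitVel hν) ρ.Tstar :=
  (ρ.isTypeIBlowup_or_isTypeIIBlowup hν).imp_left (ρ.eventually_T_le_of_isTypeIBlowup hν)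

end Cascade

/-- **Door v1, portrait form.** A transferring scheme (`ν > 0`) yields an exact forced Clay-class
blow-up `W` which is a maximal classical solution with lifespan `W.T`, blows up at a singular time,
and keeps its energy bounded on `[0, W.T)`. [cite: Tao2016AveragedNS, §1.3] -/
theorem exists_witness_portrait_of_transfers (𝒮 : TriggerScheme) {ν : ℝ} (hν : 0 < ν)
    (hT : 𝒮.Transfers ν) : ∃ W : BreakdownWitness ν,
      IsMaximalSmoothSolution ν W.f W.u W.p W.T ∧ IsSingularTime W.u W.T ∧
        ∃ B : ℝ≥0∞, B < ⊤ ∧ ∀ t ∈ Ico 0 W.T, ∫⁻ x, ‖W.u t x‖ₑ ^ 2 ≤ B := by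
  obtain ⟨ρ⟩ := 𝒮.nonempty_cascade_of_transfers hν hT
  exact ⟨ρ.toWitness hν, ρ.isMaximalSmoothSolution hν, ρ.isSingularTime hν, ρ.energy_bounded hν⟩

end TriggerScheme

namespace TriggerSchemeH1

/-- **Door v2, portrait form** (`H¹` alphabet above ignition): a transferring scheme (`ν > 0`) yields
an exact forced Clay-class blow-up which is maximal at its blow-up time, singular there, with bounded
energy up to it. [cite: Tao2016AveragedNS, §1.3] -/
theorem exists_witness_portrait_of_transfers (𝒮 : TriggerSchemeH1) {ν : ℝ} (hν : 0 < ν)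
    (hT : 𝒮.Transfers ν) : ∃ W : BreakdownWitness ν,
      IsMaximalSmoothSolution ν W.f W.u W.p W.T ∧ IsSingularTime W.u W.T ∧
        ∃ B : ℝ≥0∞, B < ⊤ ∧ ∀ t ∈ Ico 0 W.T, ∫⁻ x, ‖W.u t x‖ₑ ^ 2 ≤ B := by
  obtain ⟨ρ⟩ := 𝒮.nonempty_cascade hν hT
  exact ⟨ρ.toWitness hν, ρ.isMaximalSmoothSolution hν, ρ.isSingularTime hν, ρ.energy_bounded hν⟩

/-- **Seeded door v2, portrait form.** [cite: Tao2016AveragedNS, §1.3] -/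
theorem exists_witness_portrait_of_transfersSeeded (𝒮 : TriggerSchemeH1) {ν : ℝ} (hν : 0 < ν)
    (hT : 𝒮.TransfersSeeded ν) : ∃ W : BreakdownWitness ν,
      IsMaximalSmoothSolution ν W.f W.u W.p W.T ∧ IsSingularTime W.u W.T ∧
        ∃ B : ℝ≥0∞, B < ⊤ ∧ ∀ t ∈ Ico 0 W.T, ∫⁻ x, ‖W.u t x‖ₑ ^ 2 ≤ B := by
  obtain ⟨ρ⟩ := 𝒮.nonempty_cascade_of_seeded hT
  exact ⟨ρ.toWitness hν, ρ.isMaximalSmoothSolution hν, ρ.isSingularTime hν, ρ.energy_bounded hν⟩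

end TriggerSchemeH1

end Summit.NavierStokesRegularity.FluidComputer.TriggeredTransfer

end
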